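import Summits.BirchSwinnertonDyer.BirchSwinnertonDyer.Theorems.GenusKolyvaginAtTwoVisiblePairAtTwoShallowExactness
import Summits.BirchSwinnertonDyer.BirchSwinnertonDyer.Theorems.GenusKolyvaginAtTwoVisiblePairAtTwoVisibility
import HarnessLib

/-!
# Route `GenusKolyvaginAtTwo`, LINE 6, KEY crux Q3 (inner statement of stmt-BirchSwinnertonDyer-22137):
# exactness of the ℚ-pair instance from a SHALLOW certificate — the visibility input replaced by (H2)
# (helper, PROVED modulo the displayed inputs; seat `bsd-line-gk2-p2` g11)

Sequel to `…VisiblePairAtTwoShallowExactness` (p644336) and `…VisiblePairAtTwoVisibility` (p645204): the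
displayed visibility `hvis` of the embedded pair `{ι u, ι c_1(ℓ₀)}` is DERIVED from the instance's own (H2)
(`Input.sel_visible`) in both cases (`u` Selmer at `ℓ₀` → `hvis_of_sel_visible`; `u` ramified at `ℓ₀` →
`hvis_of_sel_visible_of_not_mem`), the bookkeeping at `ℓ₀` coming from `kolPrime W K 1 ℓ₀` (a SHALLOW Kolyvagin
prime: level `2`) and the twin's good reduction there (`…TwinGrossPrimes`).

* `selmer_eq_and_card_selmer_twin_eq_of_shallow_kolPrime` — **`Sel^{(2^M)}(E/ℚ) = ℤx` and
  `#Sel^{(2^M)}(E^{(d_K)}/ℚ) = 2^{2M₀}`** modulo: `Input`; the Cassels–Tate inputs `P₁ P₂ hCTV`; `hcsupp₁/₂`;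
  `3M₀ ≤ M`; a shallow Kolyvagin prime `ℓ₀` (`kolPrime W K 1 ℓ₀`) with `c_1(ℓ₀) ≠ 0` Selmer; an auxiliary class
  `u ≠ 0` Selmer off `ℓ₀`; the level-`2` classes `c_1(ℓ₀ℓ)`, `c_1(ℓ)` with Lemma 4.3 / Prop. 4.4 (`h43`, `h44sel`,
  `h44ord`); the Lemma 4.6 identity `hι`. No separate visibility hypothesis.

Helper (`--supports` 22137), closes nothing; THEOREMS ONLY, 0 sorry, standard axioms. Nothing about BSD, Q2, (H2) or the
Cassels–Tate value formula is proved here.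

References: [McCallumLMS1991] §1 Theorem, p. 287, Prop. 5.2, Thm. 5.4, Cor. 5.6; [GrossLMS1991] Prop. 9.1; [Kolyvagin1989Izv] §3.
-/

set_option autoImplicit false
set_option linter.dupNamespace false -- tree convention: `Summit.BirchSwinnertonDyer.BirchSwinnertonDyer.Theorems` (summit = sub-problem)

noncomputable section

open scoped Classical

namespace Summit.BirchSwinnertonDyer.BirchSwinnertonDyer.Theorems.GenusExact.VisiblePairAtTwo

open WeierstrassCurve NumberField IsDedekindDomain Field Finset Rat.HeightOneSpectrum
open Literature.NumberTheory.EllipticCurves Literature.NumberTheory.GaloisRepresentations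
open Literature.NumberTheory.EllipticCurves.KolyvaginDescent
open Summit.BirchSwinnertonDyer.BirchSwinnertonDyer.Theorems.GenusExact.TwinGrossPrimes

variable {W : WeierstrassCurve ℚ} [W.IsElliptic] [W.IsGloballyMinimal] {K : Type} [Field K] [NumberField K]
  {M : ℕ} {θ : K} {hθ : θ ∉ Set.range (algebraMap ℚ K)}
  {hθsq : θ ^ 2 = algebraMap ℚ K ((NumberField.discr K : ℤ) : ℚ)}

omit [W.IsElliptic] [W.IsGloballyMinimal] [NumberField K] in
/-- A class Selmer off `ℓ₀` (places of the instance) and Selmer at `ℓ₀` is in the Selmer group. [folklore] -/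
theorem mem_selmerGroup_of_forall_ne_pl {N ℓ₀ : ℕ} {u : galH1Torsion W (lvl N)}
    (hu : ∀ v, v ≠ pl ℓ₀ → u ∈ loc₁ W N v) (hu₀ : u ∈ loc₁ W N (pl ℓ₀)) : u ∈ selmerGroup W (lvl N) := by
  have hall : ∀ v, u ∈ loc₁ W N v := fun v ↦ by
    by_cases hv : v = pl ℓ₀
    · rw [hv]; exact hu₀
    · exact hu v hv
  rw [mem_selmerGroup_iff]
  exact ⟨fun v ↦ hall (Sum.inl v), fun w ↦ hall (Sum.inr w)⟩

/-- **The visibility input of the deepening from (H2), both cases** (`u` Selmer at `ℓ₀` or not).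
[cite: GrossLMS1991, Prop. 9.1] [cite: McCallumLMS1991, p. 299, §5 proof of Prop. 5.2] -/
theorem hvis_of_sel_visible_cases (I : Input W K M hθ hθsq) (hK : IsImaginaryQuadratic K)
    (hodd : Odd (NumberField.discr K)) [(twin W K).IsElliptic] (hM : 1 ≤ M) {ℓ₀ : ℕ} (hkol₀ : kolPrime W K 1 ℓ₀)
    {u : galH1Torsion W (lvl 1)} {y₀ : galH1Torsion (twin W K) (lvl 1)}
    (hu : ∀ v, v ≠ pl ℓ₀ → u ∈ loc₁ W 1 v) (hy : y₀ ∈ selmerGroup (twin W K) (lvl 1)) :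
    ∀ a₁' a₂' : ℤ, rK₁ W K M (a₁' • torsionH1OfDvd W (lvl_one_dvd_lvl hM) u) +
      rK₂ W M hθ hθsq (a₂' • torsionH1OfDvd (twin W K) (lvl_one_dvd_lvl hM) y₀) = 0 →
      a₁' • torsionH1OfDvd W (lvl_one_dvd_lvl hM) u = 0 ∧
        a₂' • torsionH1OfDvd (twin W K) (lvl_one_dvd_lvl hM) y₀ = 0 := by
  obtain ⟨hℓ₀, hℓ₀2, hℓ₀d, hgood, -⟩ := hkol₀
  haveI : Fact ℓ₀.Prime := ⟨hℓ₀⟩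
  by_cases hsel : u ∈ loc₁ W 1 (pl ℓ₀)
  · exact hvis_of_sel_visible I hM (mem_selmerGroup_of_forall_ne_pl hu hsel) hy
  · have h1C : (1 : VariableChange ℚ) • W.quadraticTwist ((NumberField.discr K : ℤ) : ℚ) = twin W K :=
      one_smul _ _
    have hgood' : (twin W K).HasGoodReductionAtPrime ℓ₀ :=
      hasGoodReductionAtPrime_of_smul_quadraticTwist_eq W hK.1 hodd (twin W K) h1C hℓ₀d hgood
    exact hvis_of_sel_visible_of_not_mem W K hθ hθsq M I hK hM hℓ₀2 hℓ₀d hgood hgood' hsel hy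

/-- **Exactness of the ℚ-pair at `2` from a SHALLOW Kolyvagin prime, visibility from (H2).** As
`selmer_eq_and_card_selmer_twin_eq_of_shallow`, with the visibility hypothesis of the embedded pair REPLACED by
`kolPrime W K 1 ℓ₀` (a shallow Kolyvagin prime) and `c_1(ℓ₀)` Selmer — (H2) is the instance's `Input.sel_visible`.
[cite: McCallumLMS1991, §1 Theorem, p. 287, Prop. 5.2, Thm. 5.4, Cor. 5.6] [cite: Kolyvagin1989Izv, §3] -/
theorem selmer_eq_and_card_selmer_twin_eq_of_shallow_kolPrime (I : Input W K M hθ hθsq) (hcm : ¬ W.HasCM)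
    (hΔ : W.Δ < 0) (hK : IsImaginaryQuadratic K) (hodd : Odd (NumberField.discr K))
    (hns : ¬ IsSquare ((NumberField.discr K : ℚ) * -|W.Δ|))
    (hρ : ∀ n : ℕ, W.HasSurjectiveModNGaloisRep (2 ^ n : ℕ)) [(twin W K).IsElliptic] (hM : 1 ≤ M)
    (P₁ : (visiblePair I).Sel₁ →+ (visiblePair I).Sel₁ →+ AddCircle (1 : ℚ)) (halt₁ : ∀ z, P₁ z z = 0)
    (hPx : ∀ t, P₁ ⟨(visiblePair I).x, (visiblePair I).x_mem⟩ t = 0)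
    (hnd₁ : ∀ z : (visiblePair I).Sel₁, (∀ t, P₁ z t = 0) →
      (z : galH1Torsion W (lvl M)) ∈ AddSubgroup.zmultiples (visiblePair I).x)
    (P₂ : (visiblePair I).Sel₂ →+ (visiblePair I).Sel₂ →+ AddCircle (1 : ℚ)) (halt₂ : ∀ z, P₂ z z = 0)
    (hnd₂ : ∀ z : (visiblePair I).Sel₂, (∀ t, P₂ z t = 0) → z = 0)
    (hCTV : ∀ ℓ m : ℕ, (visiblePair I).Kol ℓ → KolSupp (visiblePair I).Kol (ℓ * m) → ¬ ℓ ∣ m →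
      ∀ (j N a b : ℕ) (t : galH1Torsion W (lvl M) × galH1Torsion (twin W K) (lvl M))
        (ht : t ∈ (visiblePair I).toVisibleSplit.Sel)
        (hz : (((visiblePair I).p : ℤ) ^ j) • (visiblePair I).toVisibleSplit.c (ℓ * m) ∈
          (visiblePair I).toVisibleSplit.Sel),
      (((visiblePair I).p : ℤ) ^ N) • t = 0 →
      t ∈ (visiblePair I).toVisibleSplit.part (1 * (-1) ^ (ℓ * m).primeFactors.card) →
      (∀ q ∈ m.primeFactors, t ∈ (visiblePair I).toVisibleSplit.A q) →
      (visiblePair I).M - (visiblePair I).M₀ ≤ j → N + (visiblePair I).M₀ ≤ (visiblePair I).M → N ≤ j →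
      a + b + 1 = N →
      (((visiblePair I).p : ℤ) ^ (a + (j - N))) • (visiblePair I).toVisibleSplit.c m ∉
        (visiblePair I).toVisibleSplit.A ℓ →
      (((visiblePair I).p : ℤ) ^ b) • t ∉ (visiblePair I).toVisibleSplit.A ℓ →
      (visiblePair I).prodPairing P₁ P₂ ⟨_, hz⟩ ⟨t, ht⟩ ≠ 0)
    (hcsupp₁ : ∀ n, KolSupp (visiblePair I).Kol n → Even n.primeFactors.card →
      ∀ v, (∀ q, (visiblePair I).Kol q → v ≠ (visiblePair I).pl q) → (visiblePair I).c₁ n ∈ (visiblePair I).Loc₁ v)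
    (hcsupp₂ : ∀ n, KolSupp (visiblePair I).Kol n → Odd n.primeFactors.card →
      ∀ v, (∀ q, (visiblePair I).Kol q → v ≠ (visiblePair I).pl q) → (visiblePair I).c₂ n ∈ (visiblePair I).Loc₂ v)
    (h3 : 3 * I.M₀ ≤ M)
    -- the shallow certificate and its level-`2` data (no visibility hypothesis)
    {ℓ₀ : ℕ} (hkol₀ : kolPrime W K 1 ℓ₀) (y₀ : galH1Torsion (twin W K) (lvl 1)) (hy0 : y₀ ≠ 0)
    (hy : y₀ ∈ selmerGroup (twin W K) (lvl 1))
    (u : galH1Torsion W (lvl 1)) (hu0 : u ≠ 0) (hu : ∀ v, v ≠ pl ℓ₀ → u ∈ loc₁ W 1 v)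
    (uu : ℕ → galH1Torsion W (lvl 1)) (w : ℕ → galH1Torsion (twin W K) (lvl 1))
    (h43 : ∀ ℓ, kolPrime W K M ℓ → ℓ ≠ ℓ₀ → ∀ v, v ≠ pl ℓ₀ → v ≠ pl ℓ → uu ℓ ∈ loc₁ W 1 v)
    (h44sel : ∀ ℓ, kolPrime W K M ℓ → ℓ ≠ ℓ₀ → (uu ℓ ∈ loc₁ W 1 (pl ℓ) ↔ y₀ ∈ a₂ W K 1 ℓ))
    (h44ord : ∀ ℓ, kolPrime W K M ℓ → ℓ ≠ ℓ₀ → (uu ℓ ∈ a₁ W 1 ℓ₀ ↔ w ℓ ∈ a₂ W K 1 ℓ₀))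
    (hι : ∀ ℓ, kolPrime W K M ℓ →
      torsionH1OfDvd (twin W K) (lvl_one_dvd_lvl hM) (w ℓ) = ((2 : ℤ) ^ (M - 1)) • I.c₂ ℓ) :
    selmerGroup W (lvl M) = AddSubgroup.zmultiples I.x ∧
      Nat.card (selmerGroup (twin W K) (lvl M)) = 2 ^ (2 * I.M₀) :=
  selmer_eq_and_card_selmer_twin_eq_of_shallow I hcm hΔ hK hodd hns hρ hM P₁ halt₁ hPx hnd₁ P₂ halt₂ hnd₂
    hCTV hcsupp₁ hcsupp₂ h3 hkol₀.1 y₀ hy0 u hu0 hu uu w h43 h44sel h44ord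
    (hvis_of_sel_visible_cases I hK hodd hM hkol₀ hu hy) hι

/-! ### The same capstone with the value formula restricted to `2^{2M₀}`-torsion classes

Appended by seat `bsd-line-gk2-p2` g12: `selmer_eq_and_card_selmer_twin_eq_of_shallow_kolPrime` VERBATIM, with `hCTV` assumed only for `t` with
`2^{2M₀} t = 0` — the only classes the telescope applies it to (Selmer eigenclasses independent of `x`,
Literature `exists_chain_of_casselsTate_of_torsion`), and the form in which the Cassels–Tate pairings pulled
back to `Sel_{2^M}` actually satisfy it. -/

/-- **`selmer_eq_and_card_selmer_twin_eq_of_shallow_kolPrime`, value formula on `2^{2M₀}`-torsion classes only** (extra antecedent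
`2^{2M₀} t = 0` in `hCTV`; everything else verbatim). [cite: McCallumLMS1991, Prop. 5.2, Thm. 5.4, Cor. 5.6]
[cite: Kolyvagin1989Izv, §3] -/
theorem selmer_eq_and_card_selmer_twin_eq_of_shallow_kolPrime_of_torsion (I : Input W K M hθ hθsq) (hcm : ¬ W.HasCM)
    (hΔ : W.Δ < 0) (hK : IsImaginaryQuadratic K) (hodd : Odd (NumberField.discr K))
    (hns : ¬ IsSquare ((NumberField.discr K : ℚ) * -|W.Δ|))
    (hρ : ∀ n : ℕ, W.HasSurjectiveModNGaloisRep (2 ^ n : ℕ)) [(twin W K).IsElliptic] (hM : 1 ≤ M)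
    (P₁ : (visiblePair I).Sel₁ →+ (visiblePair I).Sel₁ →+ AddCircle (1 : ℚ)) (halt₁ : ∀ z, P₁ z z = 0)
    (hPx : ∀ t, P₁ ⟨(visiblePair I).x, (visiblePair I).x_mem⟩ t = 0)
    (hnd₁ : ∀ z : (visiblePair I).Sel₁, (∀ t, P₁ z t = 0) →
      (z : galH1Torsion W (lvl M)) ∈ AddSubgroup.zmultiples (visiblePair I).x)
    (P₂ : (visiblePair I).Sel₂ →+ (visiblePair I).Sel₂ →+ AddCircle (1 : ℚ)) (halt₂ : ∀ z, P₂ z z = 0)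
    (hnd₂ : ∀ z : (visiblePair I).Sel₂, (∀ t, P₂ z t = 0) → z = 0)
    (hCTV : ∀ ℓ m : ℕ, (visiblePair I).Kol ℓ → KolSupp (visiblePair I).Kol (ℓ * m) → ¬ ℓ ∣ m →
      ∀ (j N a b : ℕ) (t : galH1Torsion W (lvl M) × galH1Torsion (twin W K) (lvl M))
        (ht : t ∈ (visiblePair I).toVisibleSplit.Sel)
        (hz : (((visiblePair I).p : ℤ) ^ j) • (visiblePair I).toVisibleSplit.c (ℓ * m) ∈
          (visiblePair I).toVisibleSplit.Sel),
      (((visiblePair I).p : ℤ) ^ N) • t = 0 → (((visiblePair I).p : ℤ) ^ (2 * (visiblePair I).M₀)) • t = 0 →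
      t ∈ (visiblePair I).toVisibleSplit.part (1 * (-1) ^ (ℓ * m).primeFactors.card) →
      (∀ q ∈ m.primeFactors, t ∈ (visiblePair I).toVisibleSplit.A q) →
      (visiblePair I).M - (visiblePair I).M₀ ≤ j → N + (visiblePair I).M₀ ≤ (visiblePair I).M → N ≤ j →
      a + b + 1 = N →
      (((visiblePair I).p : ℤ) ^ (a + (j - N))) • (visiblePair I).toVisibleSplit.c m ∉
        (visiblePair I).toVisibleSplit.A ℓ →
      (((visiblePair I).p : ℤ) ^ b) • t ∉ (visiblePair I).toVisibleSplit.A ℓ →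
      (visiblePair I).prodPairing P₁ P₂ ⟨_, hz⟩ ⟨t, ht⟩ ≠ 0)
    (hcsupp₁ : ∀ n, KolSupp (visiblePair I).Kol n → Even n.primeFactors.card →
      ∀ v, (∀ q, (visiblePair I).Kol q → v ≠ (visiblePair I).pl q) → (visiblePair I).c₁ n ∈ (visiblePair I).Loc₁ v)
    (hcsupp₂ : ∀ n, KolSupp (visiblePair I).Kol n → Odd n.primeFactors.card →
      ∀ v, (∀ q, (visiblePair I).Kol q → v ≠ (visiblePair I).pl q) → (visiblePair I).c₂ n ∈ (visiblePair I).Loc₂ v)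
    (h3 : 3 * I.M₀ ≤ M)
    -- the shallow certificate and its level-`2` data (no visibility hypothesis)
    {ℓ₀ : ℕ} (hkol₀ : kolPrime W K 1 ℓ₀) (y₀ : galH1Torsion (twin W K) (lvl 1)) (hy0 : y₀ ≠ 0)
    (hy : y₀ ∈ selmerGroup (twin W K) (lvl 1))
    (u : galH1Torsion W (lvl 1)) (hu0 : u ≠ 0) (hu : ∀ v, v ≠ pl ℓ₀ → u ∈ loc₁ W 1 v)
    (uu : ℕ → galH1Torsion W (lvl 1)) (w : ℕ → galH1Torsion (twin W K) (lvl 1))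
    (h43 : ∀ ℓ, kolPrime W K M ℓ → ℓ ≠ ℓ₀ → ∀ v, v ≠ pl ℓ₀ → v ≠ pl ℓ → uu ℓ ∈ loc₁ W 1 v)
    (h44sel : ∀ ℓ, kolPrime W K M ℓ → ℓ ≠ ℓ₀ → (uu ℓ ∈ loc₁ W 1 (pl ℓ) ↔ y₀ ∈ a₂ W K 1 ℓ))
    (h44ord : ∀ ℓ, kolPrime W K M ℓ → ℓ ≠ ℓ₀ → (uu ℓ ∈ a₁ W 1 ℓ₀ ↔ w ℓ ∈ a₂ W K 1 ℓ₀))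
    (hι : ∀ ℓ, kolPrime W K M ℓ →
      torsionH1OfDvd (twin W K) (lvl_one_dvd_lvl hM) (w ℓ) = ((2 : ℤ) ^ (M - 1)) • I.c₂ ℓ) :
    selmerGroup W (lvl M) = AddSubgroup.zmultiples I.x ∧
      Nat.card (selmerGroup (twin W K) (lvl M)) = 2 ^ (2 * I.M₀) :=
  selmer_eq_and_card_selmer_twin_eq_of_shallow_of_torsion I hcm hΔ hK hodd hns hρ hM P₁ halt₁ hPx hnd₁ P₂ halt₂ hnd₂
    hCTV hcsupp₁ hcsupp₂ h3 hkol₀.1 y₀ hy0 u hu0 hu uu w h43 h44sel h44ord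
    (hvis_of_sel_visible_cases I hK hodd hM hkol₀ hu hy) hι

end Summit.BirchSwinnertonDyer.BirchSwinnertonDyer.Theorems.GenusExact.VisiblePairAtTwo

end
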